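import Summits.HubbardSuperconductivity.HubbardSuperconductivity.Theorems.KLProgrammeKLRegimeFlowReadScaleZeroSunsetCertDefsV2

/-!
# Route `KLProgramme`, crux K3 — engine-flow child (stmt-HubbardSuperconductivity-20437), stub (C) at `n = 0`, located item #22a «(C)-SCALE0-PT2»:
# THE LOW-SHELL CERTIFICATE FORMAT — `SunsetFarGapRecord` / `ScaleZeroFarGapCert` (KIT JOB B, «(2e)-LOW-SHELL-PLANCHEREL») + its one-line reader

Seat hubbard-kl-k3c5-p1 (g15; owner of #22a and of the two certificate predicates — pen (R221)(3)/(R228)/16:25Z l.8450).  Text prestaged by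
p1 g22 (HOME/p1/g22/…FarGapCertDefs.prestaged.lean, KL STATUS l.8547) against the closer of record
`…FlowReadScaleZeroSunsetTailKlEng.sunsetRows_of_certV3_klEng` (p650061); filed here unchanged in substance.

What the kit certifies for the far (low-frequency) half of the certified sunset rows `hS0`/`hSk` of
`…FlowReadScaleZeroAssembly.twoLegRead_frameZero_of_sunsetData`.  For the bare-frame scale-0 spatial symbol of one frequency,
`g_{μ,ω}(y) = Ψ(1, klE0; e₀(2πy) − μ, ω)` (`uvSymbolFn 1 klE0 (frameLevel μ 0 (2π•y)) ω`, `y ∈ [0,1)²`), write `a_{μ,ω}(z)` (`z ∈ ℤ²`) for its Fourier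
coefficients (`mFourierCoeff (Torus.descend …) (−z)`).  The two PARSEVAL GAPS over the near box `{0} ∪ c.disk = {‖z‖∞ ≤ c.Rc}` are
`gap₀ = ∫|g|² − Σ_{‖z‖∞≤Rc}|a(z)|²` and `gap₂ = (2π)⁻²(∫|∂₀g|² + ∫|∂₁g|²) − Σ_{‖z‖∞≤Rc}(z₀²+z₁²)|a(z)|²`, i.e. (by Parseval) the far lattice sums
`Σ_{‖z‖∞>Rc}|a|²` and `Σ_{‖z‖∞>Rc}‖z‖₂²|a|²` — exactly the binders `hgap0`/`hgap2` of `sunsetRows_of_certV3_klEng` (p1 g22's low-shell readers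
`…ScaleZeroCovarianceFarL2Images{,Bare,LowShell,Engine}` turn them into the far-site rows at every `L ≥ klEngL₃`; row 1 is free by Cauchy–Schwarz, `G₁ = √(G₀G₂)`).

* `SunsetFarGapRecord` — the low-shell record of one μ-cell: crossover `ω₁` (the closer needs `klE0 ≤ ω₁`; design value `1/4` at `Rc ≥ 1024`) and the two gap
  envelopes `G₀`, `G₂` (rationals written by `gen_record.py`);
* `ScaleZeroFarGapCert c r` — KIT JOB B's statement for the μ-cell of the near record `c` (`…SunsetCertDefsV2.SunsetCellRecordV2`; the near and far records of a cell share
  the cell and the split radius `Rc`): for every `μ ∈ [c.μlo, c.μhi]` and every `ω ≠ 0` with `|ω| < ω₁`, `gap₀(μ,ω) ≤ G₀ ∧ gap₂(μ,ω) ≤ G₂`.  Certified numerically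
  (interval arithmetic with `ω` and `μ` as interval variables — the DIFFERENCE is certified per cell, never total and near sum separately: both are `O(ω⁻²)`-large
  near the shell while the gap is the small far tail; two implementations; precision budget per ref-3 §441/(R221)(3): an ABSOLUTE per-ω gap target), discharged
  by the compute certificate (D-0022 lane), NEVER inside Lean — a named hypothesis of the closer;
* `hgaps_of_farGapCert` — the reader: the certificate at the Matsubara frequencies of the window (all nonzero, `matsubaraFreq_ne_zero'`) gives `hgap0 ∧ hgap2`.

With it the #22a rows read `sunsetRows_of_certV3_klEng c hc … hω₁ hRc (hgaps_of_farGapCert c.toSunsetCellRecordV2 r hr hβ hμlo hμhi).1 (…).2 hbS`; the record-level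
one-call (rational budget row) is the next file of this seat.  Definitions + one reader; nothing here asserts (C), any stub of 20437, K3 or superconductivity; no
certificate is claimed.  References: BGM 2006 §2.3–§2.4 [cite: BenfattoGiulianiMastropietro2006].
-/

noncomputable section

namespace Summit.HubbardSuperconductivity.HubbardSuperconductivity.Theorems.KLRegimeSplit

set_option linter.dupNamespace false -- summit = problem name (single-conjunct summit), D-0017

open Literature.MathematicalPhysics.QuantumLattice Literature.Probability.LatticeModels Literature.Analysis.FunctionSpaces
open Summit.HubbardSuperconductivity.HubbardSuperconductivity.Theorems.DispersionFlow
open MeasureTheory Finset Complex UnitAddTorus Real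

/-- **The low-shell record of one μ-cell** (KIT JOB B): crossover and the two Parseval-gap envelopes. -/
structure SunsetFarGapRecord where
  /-- crossover frequency `ω₁ ≥ klE0` between the strip (high) shell and the Plancherel (low) shell -/
  ω₁ : ℚ
  /-- envelope of the row-0 gap `∫|Ψ_ω|² − Σ_{near}|a_ω|²` over `0 < |ω| < ω₁` and the μ-cell -/
  G₀ : ℚ
  /-- envelope of the row-2 gap `(2π)⁻²Σ_j∫|∂_jΨ_ω|² − Σ_{near}(z₀²+z₁²)|a_ω|²` over `0 < |ω| < ω₁` and the μ-cell -/
  G₂ : ℚ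

/-- **`ScaleZeroFarGapCert c r`** — what KIT JOB B certifies for the μ-cell of the near record `c` and the low-shell record `r`: at every `μ` of the cell and every
frequency `0 < |ω| < ω₁`, the two Parseval gaps over the near box `{0} ∪ c.disk` are `≤ G₀`, `≤ G₂`.  A named hypothesis, certified numerically, never proved in Lean. -/
def ScaleZeroFarGapCert (c : SunsetCellRecordV2) (r : SunsetFarGapRecord) : Prop :=
  ∀ μ : ℝ, (c.μlo : ℝ) ≤ μ → μ ≤ c.μhi → ∀ om : ℝ, om ≠ 0 → |om| < r.ω₁ →
    ((∫ y in Torus.unitCube (Fin 2), ‖(fun y : Momentum => uvSymbolFn 1 klE0 (frameLevel μ 0 ((2 * π) • y)) om) y‖ ^ 2) -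
        ∑ z ∈ insert (0 : Site 2) c.disk, ‖mFourierCoeff (Torus.descend
          (fun y : Momentum => uvSymbolFn 1 klE0 (frameLevel μ 0 ((2 * π) • y)) om) (uvSpatialSymbol_isLatticePeriodic 1 klE0 μ 0 om)) (-z)‖ ^ 2 ≤ r.G₀) ∧
    ((2 * π) ^ (-(2 : ℤ)) *
        ((∫ y in Torus.unitCube (Fin 2), ‖fderiv ℝ (fun y : Momentum => uvSymbolFn 1 klE0 (frameLevel μ 0 ((2 * π) • y)) om) y (EuclideanSpace.single 0 (1 : ℝ))‖ ^ 2) +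
          ∫ y in Torus.unitCube (Fin 2), ‖fderiv ℝ (fun y : Momentum => uvSymbolFn 1 klE0 (frameLevel μ 0 ((2 * π) • y)) om) y (EuclideanSpace.single 1 (1 : ℝ))‖ ^ 2) -
        ∑ z ∈ insert (0 : Site 2) c.disk, ((((z 0 : ℤ) : ℝ)) ^ 2 + (((z 1 : ℤ) : ℝ)) ^ 2) *
          ‖mFourierCoeff (Torus.descend (fun y : Momentum => uvSymbolFn 1 klE0 (frameLevel μ 0 ((2 * π) • y)) om)
            (uvSpatialSymbol_isLatticePeriodic 1 klE0 μ 0 om)) (-z)‖ ^ 2 ≤ r.G₂)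

/-- **The reader**: the certificate at the Matsubara frequencies of the window (all nonzero) gives the binders `hgap0` and `hgap2` of `sunsetRows_of_certV3_klEng`. -/
theorem hgaps_of_farGapCert {M : ℕ} (c : SunsetCellRecordV2) (r : SunsetFarGapRecord) (hcert : ScaleZeroFarGapCert c r)
    {μ β : ℝ} (hβ : 0 < β) (hμlo : (c.μlo : ℝ) ≤ μ) (hμhi : μ ≤ c.μhi) :
    (∀ i : MatsubaraIdx M, |matsubaraFreq β M i| < r.ω₁ →
      (∫ y in Torus.unitCube (Fin 2), ‖(fun y : Momentum => uvSymbolFn 1 klE0 (frameLevel μ 0 ((2 * π) • y)) (matsubaraFreq β M i)) y‖ ^ 2) -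
        ∑ z ∈ insert (0 : Site 2) c.disk, ‖mFourierCoeff (Torus.descend
          (fun y : Momentum => uvSymbolFn 1 klE0 (frameLevel μ 0 ((2 * π) • y)) (matsubaraFreq β M i))
          (uvSpatialSymbol_isLatticePeriodic 1 klE0 μ 0 (matsubaraFreq β M i))) (-z)‖ ^ 2 ≤ r.G₀) ∧
    (∀ i : MatsubaraIdx M, |matsubaraFreq β M i| < r.ω₁ →
      (2 * π) ^ (-(2 : ℤ)) *
        ((∫ y in Torus.unitCube (Fin 2), ‖fderiv ℝ (fun y : Momentum => uvSymbolFn 1 klE0 (frameLevel μ 0 ((2 * π) • y)) (matsubaraFreq β M i)) y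
            (EuclideanSpace.single 0 (1 : ℝ))‖ ^ 2) +
          ∫ y in Torus.unitCube (Fin 2), ‖fderiv ℝ (fun y : Momentum => uvSymbolFn 1 klE0 (frameLevel μ 0 ((2 * π) • y)) (matsubaraFreq β M i)) y
            (EuclideanSpace.single 1 (1 : ℝ))‖ ^ 2) -
        ∑ z ∈ insert (0 : Site 2) c.disk, ((((z 0 : ℤ) : ℝ)) ^ 2 + (((z 1 : ℤ) : ℝ)) ^ 2) *
          ‖mFourierCoeff (Torus.descend (fun y : Momentum => uvSymbolFn 1 klE0 (frameLevel μ 0 ((2 * π) • y)) (matsubaraFreq β M i))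
            (uvSpatialSymbol_isLatticePeriodic 1 klE0 μ 0 (matsubaraFreq β M i))) (-z)‖ ^ 2 ≤ r.G₂) :=
  ⟨fun i hi => (hcert μ hμlo hμhi _ (matsubaraFreq_ne_zero' hβ i) hi).1, fun i hi => (hcert μ hμlo hμhi _ (matsubaraFreq_ne_zero' hβ i) hi).2⟩

end Summit.HubbardSuperconductivity.HubbardSuperconductivity.Theorems.KLRegimeSplit

end
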